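import Summits.Ventures.Crystal3D.Theorems.StickyWulffConstantTextureLiminfTexShadowWallDefs
import HarnessLib

/-!
# TexShadow (V) PIECED PLATES, P1: the pieced stacking and the pieced wall cell `BilayerWallPiecedAt` (cell kind reserved by TB as `PiecedCell`)
# (lane T, crux `TextureLiminfV5`, stmt-Ventures-23912; cf-p1 (clxi) 2026-08-29T08:13:12Z, (clxxxv) 09:33:17Z: Q1 = union, Q2 = (γ) one table, Q3 = loss term;
#  19480-p2 (γ′) 09:47Z: table on piece 0's lay slabs; design memo HOME/wall-p2-g12/PIECED-DESIGN-0.md)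

HONEST FRAMING. Venture `Summits/Ventures/Crystal3D` (cell `crystal3d-full`), route `route-Ventures-StickyWulffConstant`, helper
`--supports` the law-v5 crux `TextureLiminfV5` (stmt-Ventures-23912).  DEFINITIONS ONLY (+ unfolding lemmas and the `k = 1` reduction); no wall
law is asserted; rung F-C1 not moved.

THE POINT.  A PIECED plate is ONE orientation `L` and ONE word `σ` presented as `k ≤ 3` translated pieces `stacking L (s a) σ` on pairwise disjoint
territories `D a` (inclined Shockley seams between fcc runs, misfit collars elsewhere).  The wall cell reads a plate in exactly three places
(`…TexShadowWallDefs.BilayerWallAt`): membership of the clamp sample, the inner-bond count, and the flux cells `laySlab`.  The pieced cell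
**`BilayerWallPiecedAt C R₀ lam k₁ k₂ σ₁ σ₂ L₁ L₂ s₁ s₂ D₁ D₂ ℓ₁ ℓ₂ c`** is `BilayerWallAt` with
(a) membership and (b) inner bonds taken relative to the UNION `piecedStacking L σ k s D := ⋃ a, stacking L (s a) σ ∩ D a` (Q1),
(c) the flux cells indexed by PIECE 0's lay slabs `laySlab L (s 0) i` (Q2 (γ′): one table; the other pieces, offset along the axis by thirds of a layer,
    certify with the adjacent-min domination in the glue P5), and
(d) an explicit seam-loss term `+ lam·(ℓ₁ + ℓ₂)` on the right (Q3: `ℓᵢ` = the misfit-collar length of plate `i` inside the clamp, plate DATA; clean seams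
    cost nothing beyond the rim constant), paid by TB's line budget (`seamSum`).
Also: `UnitSeparated`, unfolding lemmas, `piecedStacking` for `k = 1` is the plain stacking, and **`bilayerWallPiecedAt_one_iff`**: for `k₁ = k₂ = 1`,
territories `univ` and `ℓ = 0` the pieced cell IS `BilayerWallAt` (so every landed cell is a pieced cell).  The plate-data predicate (what TB must
guarantee of `(k, s, D, ℓ)`: disjoint covering territories, clean-seam geometry, collars, unit separation) comes with the sealing file P2.
WHAT THIS IS NOT: no certificate, no sealing / frame lemma, no statement about seams; F-C1 not moved.
-/

noncomputable section

open scoped BigOperators InnerProductSpace ENNReal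
open MeasureTheory Filter

namespace Summit.Ventures.Crystal3D.Cruxes.TextureLiminf.TexShadow

open Summit.Ventures.Crystal3D
open Literature.MathematicalPhysics.StatisticalMechanics (IsHaggSeq fccStacking barlowStacking contactDeficiency)

/-! ## Unit separation, pieced stackings -/

/-- A unit-separated point set (hard cores of diameter `1`). -/
def UnitSeparated (S : Set E3) : Prop :=
  ∀ p ∈ S, ∀ q ∈ S, p ≠ q → 1 ≤ dist p q

/-- **The pieced stacking**: `k` translated copies `stacking L (s a) σ` of ONE oriented Barlow stacking, each restricted to its territory `D a`. -/
def piecedStacking (L : E3 ≃ₗᵢ[ℝ] E3) (σ : ℤ → ℤ) (k : ℕ) (s : Fin k → E3) (D : Fin k → Set E3) : Set E3 :=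
  ⋃ a : Fin k, (stacking L (s a) σ ∩ D a)

/-- Membership in the pieced stacking. -/
theorem mem_piecedStacking_iff (L : E3 ≃ₗᵢ[ℝ] E3) (σ : ℤ → ℤ) (k : ℕ) (s : Fin k → E3) (D : Fin k → Set E3) (p : E3) :
    p ∈ piecedStacking L σ k s D ↔ ∃ a : Fin k, p ∈ stacking L (s a) σ ∧ p ∈ D a := by
  simp only [piecedStacking, Set.mem_iUnion, Set.mem_inter_iff]

/-- Each piece (on its territory) is part of the pieced stacking. -/
theorem stacking_inter_subset_piecedStacking (L : E3 ≃ₗᵢ[ℝ] E3) (σ : ℤ → ℤ) (k : ℕ) (s : Fin k → E3) (D : Fin k → Set E3)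
    (a : Fin k) : stacking L (s a) σ ∩ D a ⊆ piecedStacking L σ k s D :=
  Set.subset_iUnion (fun a : Fin k => stacking L (s a) σ ∩ D a) a

/-- The pieced stacking lies in the union of the territories. -/
theorem piecedStacking_subset_iUnion (L : E3 ≃ₗᵢ[ℝ] E3) (σ : ℤ → ℤ) (k : ℕ) (s : Fin k → E3) (D : Fin k → Set E3) :
    piecedStacking L σ k s D ⊆ ⋃ a : Fin k, D a :=
  Set.iUnion_mono fun _ => Set.inter_subset_right

/-- **One piece on the whole space is the plain stacking**: `piecedStacking L σ 1 s (fun _ => univ) = stacking L (s 0) σ`. -/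
theorem piecedStacking_one (L : E3 ≃ₗᵢ[ℝ] E3) (σ : ℤ → ℤ) (s : Fin 1 → E3) :
    piecedStacking L σ 1 s (fun _ => Set.univ) = stacking L (s 0) σ := by
  ext p
  rw [mem_piecedStacking_iff]
  constructor
  · rintro ⟨a, ha, -⟩
    rwa [Subsingleton.elim a 0] at ha
  · exact fun hp => ⟨0, hp, Set.mem_univ _⟩

/-! ## The pieced wall cell -/

/-- **THE PIECED WALL CELL INEQUALITY** with explicit constants (`C` rim, `R₀`, `lam` seam-loss coefficient) for ONE pair of pieced plates
(`kᵢ` pieces, origins `sᵢ`, territories `Dᵢ`, misfit-collar lengths `ℓᵢ`) and ONE charge table `c` (indexed by PIECE 0's lay slabs): verbatim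
`BilayerWallAt` with the clamp samples and inner bonds taken in the pieced stackings and `+ lam·(ℓ₁ + ℓ₂)` added on the right. -/
def BilayerWallPiecedAt (C R₀ lam : ℝ) (k₁ k₂ : ℕ) (σ₁ σ₂ : ℤ → ℤ) (L₁ L₂ : E3 ≃ₗᵢ[ℝ] E3)
    (s₁ : Fin k₁ → E3) (s₂ : Fin k₂ → E3) (D₁ : Fin k₁ → Set E3) (D₂ : Fin k₂ → Set E3) (ℓ₁ ℓ₂ : ℝ)
    (i₁ : Fin k₁) (i₂ : Fin k₂) (c : ℤ → ℤ → ℝ) : Prop :=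
  ∀ h : ℝ, 0 ≤ h → ∀ ρ : ℝ, R₀ ≤ ρ → ∀ X P₁ P₂ : Finset E3,
    (∀ p ∈ X, ∀ q ∈ X, p ≠ q → 1 ≤ dist p q) → P₁ ⊆ X → P₂ ⊆ X \ P₁ → (∀ p ∈ X, p ∈ cyl R₀ h ρ) →
    (∀ p, p ∈ P₁ ↔ (p ∈ piecedStacking L₁ σ₁ k₁ s₁ D₁ ∧ -(2 * R₀) ≤ p 2 ∧ p 2 ≤ -R₀ ∧ p 0 ^ 2 + p 1 ^ 2 ≤ ρ ^ 2)) →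
    (∀ p, p ∈ P₂ ↔ (p ∈ piecedStacking L₂ σ₂ k₂ s₂ D₂ ∧ h + R₀ ≤ p 2 ∧ p 2 ≤ h + 2 * R₀ ∧ p 0 ^ 2 + p 1 ^ 2 ≤ ρ ^ 2)) →
    ((((P₁ ×ˢ (X \ P₁)).filter fun pq => dist pq.1 pq.2 = 1).card : ℕ) : ℝ) +
      ((((P₂ ×ˢ ((X \ P₁) \ P₂)).filter fun pq => dist pq.1 pq.2 = 1).card : ℕ) : ℝ) ≤
      contactDeficiency ((X \ P₁) \ P₂) +
        1 / 2 * innerBonds (piecedStacking L₁ σ₁ k₁ s₁ D₁) P₁ (fun q => -R₀ < q 2) +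
        1 / 2 * innerBonds (piecedStacking L₂ σ₂ k₂ s₂ D₂) P₂ (fun q => q 2 < h + R₀) -
        (∑' ij : ℤ × ℤ, c ij.1 ij.2 *
          (volume ({q : E3 | 0 ≤ q 2 ∧ q 2 ≤ 1 ∧ q 0 ^ 2 + q 1 ^ 2 ≤ ρ ^ 2} ∩
            laySlab L₁ (s₁ i₁) ij.1 ∩ laySlab L₂ (s₂ i₂) ij.2)).toReal) +
        C * (1 + h) * ρ + lam * (ℓ₁ + ℓ₂)

/-- The pieced cell is MONOTONE in the rim constant `C` (`R₀ ≥ 0`). -/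
theorem bilayerWallPiecedAt_mono {C C' R₀ lam : ℝ} (hR : 0 ≤ R₀) (hCC' : C ≤ C') {k₁ k₂ : ℕ} {σ₁ σ₂ : ℤ → ℤ}
    {L₁ L₂ : E3 ≃ₗᵢ[ℝ] E3} {s₁ : Fin k₁ → E3} {s₂ : Fin k₂ → E3} {D₁ : Fin k₁ → Set E3} {D₂ : Fin k₂ → Set E3} {ℓ₁ ℓ₂ : ℝ}
    {i₁ : Fin k₁} {i₂ : Fin k₂} {c : ℤ → ℤ → ℝ}
    (hW : BilayerWallPiecedAt C R₀ lam k₁ k₂ σ₁ σ₂ L₁ L₂ s₁ s₂ D₁ D₂ ℓ₁ ℓ₂ i₁ i₂ c) :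
    BilayerWallPiecedAt C' R₀ lam k₁ k₂ σ₁ σ₂ L₁ L₂ s₁ s₂ D₁ D₂ ℓ₁ ℓ₂ i₁ i₂ c := by
  intro h hh ρ hρ X P₁ P₂ hX hP₁ hP₂ hcyl hP₁def hP₂def
  have key := hW h hh ρ hρ X P₁ P₂ hX hP₁ hP₂ hcyl hP₁def hP₂def
  have hρ0 : 0 ≤ ρ := le_trans hR hρ
  have hmono : C * (1 + h) * ρ ≤ C' * (1 + h) * ρ := by
    have h1 : 0 ≤ (1 + h) * ρ := mul_nonneg (by linarith) hρ0
    nlinarith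
  linarith

/-- The pieced cell is MONOTONE in the seam-loss coefficient (`ℓ₁ + ℓ₂ ≥ 0`). -/
theorem bilayerWallPiecedAt_mono_lam {C R₀ lam lam' : ℝ} (hll : lam ≤ lam') {k₁ k₂ : ℕ} {σ₁ σ₂ : ℤ → ℤ}
    {L₁ L₂ : E3 ≃ₗᵢ[ℝ] E3} {s₁ : Fin k₁ → E3} {s₂ : Fin k₂ → E3} {D₁ : Fin k₁ → Set E3} {D₂ : Fin k₂ → Set E3} {ℓ₁ ℓ₂ : ℝ}
    (hℓ : 0 ≤ ℓ₁ + ℓ₂) {i₁ : Fin k₁} {i₂ : Fin k₂} {c : ℤ → ℤ → ℝ}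
    (hW : BilayerWallPiecedAt C R₀ lam k₁ k₂ σ₁ σ₂ L₁ L₂ s₁ s₂ D₁ D₂ ℓ₁ ℓ₂ i₁ i₂ c) :
    BilayerWallPiecedAt C R₀ lam' k₁ k₂ σ₁ σ₂ L₁ L₂ s₁ s₂ D₁ D₂ ℓ₁ ℓ₂ i₁ i₂ c := by
  intro h hh ρ hρ X P₁ P₂ hX hP₁ hP₂ hcyl hP₁def hP₂def
  have key := hW h hh ρ hρ X P₁ P₂ hX hP₁ hP₂ hcyl hP₁def hP₂def
  have hmono : lam * (ℓ₁ + ℓ₂) ≤ lam' * (ℓ₁ + ℓ₂) := mul_le_mul_of_nonneg_right hll hℓ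
  linarith

/-! ## One piece per plate: the pieced cell is the landed cell -/

/-- **`k₁ = k₂ = 1`, territories `univ`, no collars: the pieced cell IS `BilayerWallAt`** (so every landed wall cell is a pieced cell, and the pieced
K1a glue P5 specialises back to the one-piece glue). -/
theorem bilayerWallPiecedAt_one_iff (C R₀ lam : ℝ) (σ₁ σ₂ : ℤ → ℤ) (L₁ L₂ : E3 ≃ₗᵢ[ℝ] E3) (s₁ s₂ : Fin 1 → E3) (c : ℤ → ℤ → ℝ) :
    BilayerWallPiecedAt C R₀ lam 1 1 σ₁ σ₂ L₁ L₂ s₁ s₂ (fun _ => Set.univ) (fun _ => Set.univ) 0 0 0 0 c ↔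
      BilayerWallAt C R₀ σ₁ σ₂ L₁ L₂ (s₁ 0) (s₂ 0) c := by
  unfold BilayerWallPiecedAt BilayerWallAt
  simp only [piecedStacking_one, add_zero, mul_zero]

/-- The landed cell for `(L₁, s₁, σ₁), (L₂, s₂, σ₂)` as a one-piece pieced cell (any `lam`). -/
theorem bilayerWallPiecedAt_one_of_bilayerWallAt {C R₀ : ℝ} (lam : ℝ) {σ₁ σ₂ : ℤ → ℤ} {L₁ L₂ : E3 ≃ₗᵢ[ℝ] E3} {s₁ s₂ : E3}
    {c : ℤ → ℤ → ℝ} (hW : BilayerWallAt C R₀ σ₁ σ₂ L₁ L₂ s₁ s₂ c) :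
    BilayerWallPiecedAt C R₀ lam 1 1 σ₁ σ₂ L₁ L₂ (fun _ => s₁) (fun _ => s₂) (fun _ => Set.univ) (fun _ => Set.univ) 0 0 0 0 c :=
  (bilayerWallPiecedAt_one_iff C R₀ lam σ₁ σ₂ L₁ L₂ (fun _ => s₁) (fun _ => s₂) c).2 hW

end Summit.Ventures.Crystal3D.Cruxes.TextureLiminf.TexShadow

end
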